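import Summits.BirchSwinnertonDyer.Rank1Residual.Additive.GoodModelReductionKernel
import Literature.NumberTheory.EllipticCurves.OrdinaryReductionKernelTorsionProofs
import Literature.NumberTheory.EllipticCurves.EmertonPollackWeston2006.NearlyOrdinaryAlgebraicTransfer
import Summits.BirchSwinnertonDyer.Rank1Residual.X2.GreenbergVatsalTateDatumCofree
import Summits.BirchSwinnertonDyer.Rank1Residual.X2.GreenbergVatsalReductionDatum
import HarnessLib

/-!
# T-ROL-G F-A2: the local datum `C = E[p^∞] ∩ ker(red_{W₀} ∘ Φ_C)` of a good model of `E/ℚ` at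
# `v ∋ p` — `D_v`-stable; under the ordinary hypothesis divisible, proper, non-zero, with
# infinitely many reductions (team n1011, row T-ROL-G; seat p05 GEN 5; lead R5-57; referee-1
# ACK-1 GEN 16)

HONEST FRAMING (cell `b2b-bsdres`, run/shared/lean/b2b/bsd-rank1-residual/, verbatim in every
file): the goal of the cell is to DELETE the COMBINATION-SHAPED residual classes of the
Birch–Swinnerton-Dyer formula for ALL analytic-rank `≤ 1` elliptic curves over `ℚ` — "full BSD
formula for every rank `≤ 1` curve in class `C`" assembled STRICTLY from published theorems — so
that the rank-`≤ 1` remainder becomes exactly the CONSTRUCTION-SHAPED classes, which are TYPED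
(missing-input `Prop`s), NOT attempted. This is not "finishing BSD". Team n1011 (N10/N11): research
route on the CONSTRUCTION-SHAPED classes X3♯(G-ord)/X4♯(G-ord); prove what is provable now; no
claim beyond stated classes; census output = EVIDENCE, never a Literature fact; RESIDUAL-MAP marks
UNCHANGED; nothing is booked by this file. TOOL theorems only: NO definition, NO named fact, NO
conjecture node. The local datum is produced inside an `∃` and characterised by a membership `iff` (p10 FILE B
style); all later statements take `(Lv) (hLv : ∀ m, m ∈ Lv.plus ↔ …)`.

## The row (T-ROL-G) in one paragraph

p10's TB-ROL FILE B (`Additive/GordRamifiedOrdinaryLine.lean`) constructs the ramified ordinary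
line of an X4♯(G-ord)/X3♯(G-ord) row as Greenberg's `C_v(V)` of a `ℚ`-MODEL `V` of the `p*`-twist,
hence only for the defect `e_E(p) = 2` (Kodaira `I₀*`). On the rows with `e ∈ {3, 4, 6}` (`p ≥ 5`,
`p ≡ 1 (mod e)`; N10 `CellGordHigher`) no curve over `ℚ` plays `V` (class file of record:
"Gord_e346 — line existence / R-D untyped", class-closure/N10/WEEK-2026-08-28-INPUT-typer2 §5). The
row builds the line WITHOUT a twist model and WITHOUT any number-field extension, from a **good
model** `W₀ = C • E ⊗ K̄_v` — a Weierstrass equation with unit discriminant over the valuation ring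
`𝒪_w` of the spectral valuation `w = |·|_v` of `K̄_v = \overline{ℚ_v}`, `C` a change of variables
over `K̄_v` (it exists iff `ord_p j(E) ≥ 0`: Deuring's form, the tree's
`exists_variableChange_eq_baseChange_isUnit_Δ_of_val_j_le_one`) — as
`C = E[p^∞] ∩ ker(red_{W₀} ∘ Φ_C ∘ ι)` (`Φ_C` the substitution, `ι : E(ℚ̄) → E(K̄_v)` the chosen
embedding), and proves the five conjuncts of cc-typer-1's
`EmertonPollackWeston2006.IsRamifiedOrdinaryLine W p` (EPW §3.1's `A'_{f̃,a}`; Coates' canonical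
subgroup, LNM 1716 (62); Greenberg's `ℱ[p^∞]` over the good field, LNM 1716 §2 pp. 62–63) from tree
theorems only. Three files: F-A1 `GoodModelReductionKernel` (valued-field level), F-A2
`GoodModelReductionDatum` (the datum; divisible / proper / non-zero / infinitely many reductions
under the ordinary hypothesis), F-A3 `GoodModelReductionLine` (inertia finite + non-trivial;
assembly).

## This file (`E = W/ℚ` elliptic, `v ∋ p`, good model `(C, W₀, hW₀, hΔ)` over `𝒪_w ⊂ K̄_v`, the
## reduction map `red = red_{W₀} ∘ Φ_C` on `E(K̄_v)` as an abstract additive map pinned by `hred`)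

* §1 `red_smul_eq_zero_iff` — `ker red` is `Γ_{ℚ_v}`-stable (every `σ ∈ Γ_{ℚ_v}` is a
  `|·|_v`-isometry; F-A1); **`exists_localDatum_mem_iff_red_eq_zero`** — the
  `GreenbergSelmer.LocalDatum` on `E[p^∞]` at `v` with `m ∈ plus ↔ red(ι m) = Õ`.
* §2 (under the tree's ORDINARY hypothesis `hord : ∃ P, p • P = 0 ∧ red_{W₀} P ≠ Õ` of
  `OrdinaryReductionKernelTorsionProofs` §5: ordinary filtration of a good model over a valuation
  ring of the algebraically closed `K̄_v`) `plus_divisible_of_goodModel` (`E₁` is `p`-divisible +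
  torsion is algebraic, X2's `exists_primaryTorsion_pointsMap_eq`), `plus_ne_top_of_goodModel` (the
  ordinary point), `plus_ne_bot_of_goodModel` (`E₁ ∩ E[p]` cyclic of order `p`),
  `infinite_range_red_pointsMap` (the reductions of `E[p^∞]` form an infinite set: `#E[p^r] = p^{2r}`
  (`card_torsionBy_eq_sq`), kernel of order `p^r`, first isomorphism theorem) — Greenberg's
  "`ℱ[p^∞] ≅ ℚ_p/ℤ_p`, `Ẽ[p^∞] ≅ ℚ_p/ℤ_p`" for the good model; `charP_residueField_specVal`.

References: J.-P. Serre, J. Tate, Ann. of Math. 88 (1968) §2 Thm. 2, Cor. 2 [SerreTate1968];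
J. H. Silverman, *AEC* 2nd ed. VII.1.3(d), VII.2.1, VII.3.1(b), VII.5.5, VII.7.1, III.6.4(b)
[SilvermanAEC2009]; R. Greenberg, LNM 1716 (1999) §1 p. 62, §2 pp. 62–63 [GreenbergLNM1716];
J. Coates, LNM 1716 (1999) p. 31 (62) [CoatesLNM1716]; M. Emerton, R. Pollack, T. Weston, Invent.
Math. 163 (2006) §3.1 (arXiv:math/0404484 p. 17) [EmertonPollackWeston2006]; J. Neukirch, *ANT*
IV §1 (Krull topology); cells/n1011/skel/T-ROL-G.md (fa05b6d488a62a53), referee-1 GEN 16 ACK-1,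
lead R5-57; class-closure/N10/WEEK-2026-08-28-INPUT-typer2.md §2/§3/§5.
-/

noncomputable section

open scoped Classical NNReal

open WeierstrassCurve

universe u

namespace Summit.BirchSwinnertonDyer.Rank1Residual.Additive.GoodModelLine

open Literature.NumberTheory.EllipticCurves

/-! ## §1 The local datum `C = E[p^∞] ∩ ker(red_{W₀} ∘ Φ_C)` of a good model of `E/ℚ` at `v ∋ p` -/


section Local

open NumberField IsDedekindDomain Field IsDedekindDomain.HeightOneSpectrum
  Literature.NumberTheory.GaloisRepresentations
  Literature.NumberTheory.EllipticCurves.GreenbergSelmer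
  Literature.NumberTheory.EllipticCurves.EmertonPollackWeston2006
  Summit.BirchSwinnertonDyer.Rank1Residual.X2.GreenbergVatsalReductionDatum
  Summit.BirchSwinnertonDyer.Rank1Residual.X2.GreenbergVatsalTateDatumCofree

variable (W : WeierstrassCurve ℚ) [W.IsElliptic] (p : ℕ) [hp : Fact p.Prime]
  {v : HeightOneSpectrum (𝓞 ℚ)}
  {C : VariableChange (AlgebraicClosure (v.adicCompletion ℚ))}
  {W₀ : WeierstrassCurve (specVal v).integer}
  (hW₀ : C • (W.baseChange (v.adicCompletion ℚ)).baseChange (AlgebraicClosure (v.adicCompletion ℚ)) =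
    W₀.baseChange (AlgebraicClosure (v.adicCompletion ℚ)))
  (hΔ : IsUnit W₀.Δ)
  (red : localPoints W (v.adicCompletion ℚ) →+
    (W₀.map (IsLocalRing.residue (specVal v).integer)).toAffine.Point)
  (hred : ∀ P, red P = goodReductionHom W₀ (Valuation.integer.integers (specVal v)) hΔ
    (Affine.Point.congrEquiv hW₀ (VariableChange.pointEquiv _ C
      (Affine.Point.congrEquiv (baseChange_baseChange_adicCompletion W v).symm P))))

omit [W.IsElliptic] in
include hred in
/-- **`ker(red_{W₀} ∘ Φ_C)` is `Γ_{ℚ_v}`-STABLE** for every good model `W₀ = C • E ⊗ K̄_v` over the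
valuation ring of the spectral valuation of `K̄_v` (every `σ ∈ Γ_{ℚ_v}` is a `|·|_v`-isometry,
`spectralValuation_smul`; then `goodReductionHom_pointEquiv_map_eq_zero_iff`). This is the
`D_v`-stability of the Serre–Tate line at a potentially good prime, with NO model over `ℚ_v` or over
a number field. [cite: SerreTate1968, §2 Thm. 2 (mechanism of proof)]
[cite: SilvermanAEC2009, VII.1 Prop. 1.3(d) and VII.2 Prop. 2.1] -/
theorem red_smul_eq_zero_iff (σ : absoluteGaloisGroup (v.adicCompletion ℚ))
    (P : localPoints W (v.adicCompletion ℚ)) : red (σ • P) = 0 ↔ red P = 0 := by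
  rw [hred, hred, congrEquiv_smul W v σ P]
  exact goodReductionHom_pointEquiv_map_eq_zero_iff (W.baseChange (v.adicCompletion ℚ)) C hW₀ hΔ
    (absoluteGaloisGroup.toAlgEquiv _ σ) (fun z ↦ spectralValuation_smul (specVal_spec v) σ z) _

omit [W.IsElliptic] hp in
include hred in
/-- **The local datum of a good model**: there is a Greenberg local datum `Lv` of `E[p^∞]` at `v`
(cc-typer-1 / `GreenbergSelmer.LocalDatum`: a `D_v`-stable subgroup) whose underlying subgroup is
EXACTLY `C = {m ∈ E[p^∞] : red_{W₀}(Φ_C(ι m)) = Õ}` — the `p`-power torsion of the kernel of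
reduction of the good model (`ι : E(ℚ̄) → E(K̄_v)` the chosen embedding). Stability under `D_v` is
`red_smul_eq_zero_iff` read through `pointsMap_absGaloisRestrict_smul`. (Serre–Tate's line; for a
good ORDINARY model this is Greenberg's `ℱ[p^∞]`, LNM 1716 §2 p. 62–63, over the good field.)
[cite: SerreTate1968, §2 Thm. 2 (mechanism of proof)] [cite: GreenbergLNM1716, §1 p. 62 and §2 p. 63] -/
theorem exists_localDatum_mem_iff_red_eq_zero :
    ∃ Lv : LocalDatum ℚ (W.geomPrimaryTorsion p) v,
      ∀ m, m ∈ Lv.plus ↔ red (pointsMap W (v.adicCompletion ℚ) (m : W.geomPoints)) = 0 := by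
  refine ⟨⟨(red.comp ((pointsMap W (v.adicCompletion ℚ)).comp
      (W.geomPrimaryTorsion p).subtype)).ker, ?_⟩, fun m ↦ Iff.rfl⟩
  intro σ m hm
  rw [AddMonoidHom.mem_ker, AddMonoidHom.comp_apply, AddMonoidHom.comp_apply,
    AddSubgroup.coe_subtype] at hm ⊢
  rw [primaryComponent.coe_smul, pointsMap_absGaloisRestrict_smul, red_smul_eq_zero_iff W hW₀ hΔ red hred]
  exact hm

/-! ## §2 Under the ordinary hypothesis: `C` is divisible, proper and non-zero; its reductions are infinite -/


variable (hord : ∃ P : (W₀.baseChange (AlgebraicClosure (v.adicCompletion ℚ))).toAffine.Point,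
    (p : ℤ) • P = 0 ∧ goodReductionHom W₀ (Valuation.integer.integers (specVal v)) hΔ P ≠ 0)
  (Lv : LocalDatum ℚ (W.geomPrimaryTorsion p) v)
  (hLv : ∀ m, m ∈ Lv.plus ↔ red (pointsMap W (v.adicCompletion ℚ) (m : W.geomPoints)) = 0)

/-- `p ∈ 𝔪_w`: the residue field of the valuation ring of `|·|_v` on `K̄_v` (`v ∋ p`) has
characteristic `p`. [folklore] -/
theorem charP_residueField_specVal (hpv : ((p : ℕ) : 𝓞 ℚ) ∈ v.asIdeal) :
    CharP (IsLocalRing.ResidueField ↥(specVal v).valuationSubring) p := by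
  have hvO : (specVal v).Integers (specVal v).valuationSubring :=
    Valuation.valuationSubring.integers _
  have hpO : specVal v ((p : ℕ) : AlgebraicClosure (v.adicCompletion ℚ)) < 1 := by
    have h := spectralValuation_algebraMap_ringOfIntegers_lt_one (v := v) (specVal_spec v) hpv
    rwa [map_natCast] at h
  refine (CharP.charP_iff_prime_eq_zero hp.out).mpr ?_
  rw [← map_natCast (IsLocalRing.residue ↥(specVal v).valuationSubring),
    IsLocalRing.residue_eq_zero_iff, IsLocalRing.mem_maximalIdeal, mem_nonunits_iff,
    hvO.isUnit_iff_valuation_eq_one]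
  exact fun h ↦ absurd h (ne_of_lt (by simpa using hpO))

include hred hLv hord in
/-- **`C` is `p`-DIVISIBLE** (first conjunct of `IsRamifiedOrdinaryLine`): for `m ∈ C` the tree's
ordinary filtration (`exists_nsmul_eq_of_goodReductionHom_eq_zero`: the kernel of reduction of a
good model over a valuation ring of the algebraically closed `K̄_v` is `p`-divisible under the
ordinary hypothesis) gives `R` in the kernel with `pR = Φ(ι m)`; `R` is torsion, hence `Φ(ι m')`
for a `p`-power torsion `m'` (`exists_primaryTorsion_pointsMap_eq`), `m' ∈ C` and `p m' = m`.
Greenberg's "`ℱ[p^∞] ≅ ℚ_p/ℤ_p`" (LNM 1716 §2 p. 63) for the good model.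
[cite: GreenbergLNM1716, §1 p. 62 and §2 p. 63] [cite: SilvermanAEC2009, Prop. VII.2.1] -/
theorem plus_divisible_of_goodModel (hpv : ((p : ℕ) : 𝓞 ℚ) ∈ v.asIdeal) :
    ∀ m ∈ Lv.plus, ∃ m' ∈ Lv.plus, p • m' = m := by
  haveI := charP_residueField_specVal p hpv
  let Φ₁ : localPoints W (v.adicCompletion ℚ) ≃+
      ((W.baseChange (v.adicCompletion ℚ)).baseChange (AlgebraicClosure (v.adicCompletion ℚ))).toAffine.Point :=
    Affine.Point.congrEquiv (baseChange_baseChange_adicCompletion W v).symm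
  set Φ : localPoints W (v.adicCompletion ℚ) ≃+
      (W₀.baseChange (AlgebraicClosure (v.adicCompletion ℚ))).toAffine.Point :=
    (Φ₁.trans (VariableChange.pointEquiv _ C)).trans (Affine.Point.congrEquiv hW₀) with hΦ
  have hredΦ : ∀ P, red P = goodReductionHom W₀ (Valuation.integer.integers (specVal v)) hΔ (Φ P) :=
    fun P ↦ hred P
  intro m hm
  obtain ⟨k, hk⟩ := (AddCommGroup.mem_primaryComponent).1 m.2
  have hm0 : goodReductionHom W₀ (Valuation.integer.integers (specVal v)) hΔ
      (Φ (pointsMap W (v.adicCompletion ℚ) (m : W.geomPoints))) = 0 := by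
    rw [← hredΦ]; exact (hLv m).mp hm
  obtain ⟨R, hR0, hpR⟩ :
      ∃ R, goodReductionHom W₀ (Valuation.integer.integers (specVal v)) hΔ R = 0 ∧
        p • R = Φ (pointsMap W (v.adicCompletion ℚ) (m : W.geomPoints)) := by
    haveI : CharZero (AlgebraicClosure (v.adicCompletion ℚ)) := charZero_of_injective_algebraMap
      (algebraMap ℚ (AlgebraicClosure (v.adicCompletion ℚ))).injective
    exact exists_nsmul_eq_of_goodReductionHom_eq_zero (O := (specVal v).valuationSubring)
      (Valuation.integer.integers (specVal v)) hΔ hord _ hm0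
  -- `Q = Φ⁻¹ R` is `p^{k+1}`-torsion, hence algebraic
  set Q : localPoints W (v.adicCompletion ℚ) := Φ.symm R with hQ
  have hpQ : p • Q = pointsMap W (v.adicCompletion ℚ) (m : W.geomPoints) := by
    apply Φ.injective
    rw [map_nsmul, hQ, AddEquiv.apply_symm_apply]
    exact hpR
  have hQtors : p ^ (k + 1) • Q = 0 := by
    rw [pow_succ, mul_smul, hpQ, ← map_nsmul, hk, map_zero]
  obtain ⟨m', hm'⟩ := exists_primaryTorsion_pointsMap_eq W p Q (k + 1) hQtors
  refine ⟨m', (hLv m').mpr ?_, ?_⟩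
  · rw [hredΦ, hm', hQ, AddEquiv.apply_symm_apply]
    exact hR0
  · apply pointsMap_coe_injective W p (v := v)
    change pointsMap W (v.adicCompletion ℚ) ((p • m' : W.geomPrimaryTorsion p) : W.geomPoints) =
      pointsMap W (v.adicCompletion ℚ) (m : W.geomPoints)
    rw [AddSubmonoidClass.coe_nsmul, map_nsmul, hm', hpQ]

include hred hLv hord in
/-- **`C ≠ E[p^∞]`** (second conjunct): the ordinary point of the hypothesis — a `p`-torsion point of
`W₀(K̄_v)` with non-zero reduction — is `Φ(ι m)` for some `m ∈ E[p^∞]` (torsion is algebraic), and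
that `m ∉ C`. [cite: GreenbergLNM1716, §1 p. 62 and §2 p. 63] -/
theorem plus_ne_top_of_goodModel : Lv.plus ≠ ⊤ := by
  let Φ₁ : localPoints W (v.adicCompletion ℚ) ≃+
      ((W.baseChange (v.adicCompletion ℚ)).baseChange (AlgebraicClosure (v.adicCompletion ℚ))).toAffine.Point :=
    Affine.Point.congrEquiv (baseChange_baseChange_adicCompletion W v).symm
  set Φ : localPoints W (v.adicCompletion ℚ) ≃+
      (W₀.baseChange (AlgebraicClosure (v.adicCompletion ℚ))).toAffine.Point :=
    (Φ₁.trans (VariableChange.pointEquiv _ C)).trans (Affine.Point.congrEquiv hW₀) with hΦ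
  have hredΦ : ∀ P, red P = goodReductionHom W₀ (Valuation.integer.integers (specVal v)) hΔ (Φ P) :=
    fun P ↦ hred P
  obtain ⟨P₀, hpP₀, hP₀⟩ := hord
  set Q : localPoints W (v.adicCompletion ℚ) := Φ.symm P₀ with hQ
  have hQtors : p ^ 1 • Q = 0 := by
    apply Φ.injective
    rw [map_nsmul, hQ, AddEquiv.apply_symm_apply, pow_one, ← natCast_zsmul, hpP₀, map_zero]
  obtain ⟨m, hm⟩ := exists_primaryTorsion_pointsMap_eq W p Q 1 hQtors
  intro htop
  have hmC : m ∈ Lv.plus := htop ▸ AddSubgroup.mem_top m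
  apply hP₀
  rw [← AddEquiv.apply_symm_apply Φ P₀, ← hQ, ← hm, ← hredΦ]
  exact (hLv m).mp hmC

include hred hLv hord in
/-- **`C ≠ 0`** (third conjunct): the kernel of reduction of the good model contains a point of
order exactly `p` (`exists_generator_torsionBy_ker_goodReductionHom`, level `1`: `E₁ ∩ E[p]` is
cyclic of order `p` under the ordinary hypothesis), which is `Φ(ι m₀)` with `m₀ ∈ C`, `m₀ ≠ 0`.
Greenberg–Vatsal's "`d⁺ = 1`" for the good model. [cite: GreenbergLNM1716, §1 p. 62 and §2 p. 63]
[cite: GreenbergVatsal2000, §2 p. 14] -/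
theorem plus_ne_bot_of_goodModel (hpv : ((p : ℕ) : 𝓞 ℚ) ∈ v.asIdeal) : Lv.plus ≠ ⊥ := by
  haveI := charP_residueField_specVal p hpv
  let Φ₁ : localPoints W (v.adicCompletion ℚ) ≃+
      ((W.baseChange (v.adicCompletion ℚ)).baseChange (AlgebraicClosure (v.adicCompletion ℚ))).toAffine.Point :=
    Affine.Point.congrEquiv (baseChange_baseChange_adicCompletion W v).symm
  set Φ : localPoints W (v.adicCompletion ℚ) ≃+
      (W₀.baseChange (AlgebraicClosure (v.adicCompletion ℚ))).toAffine.Point :=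
    (Φ₁.trans (VariableChange.pointEquiv _ C)).trans (Affine.Point.congrEquiv hW₀) with hΦ
  have hredΦ : ∀ P, red P = goodReductionHom W₀ (Valuation.integer.integers (specVal v)) hΔ (Φ P) :=
    fun P ↦ hred P
  obtain ⟨P₀, hP₀0, hordP₀⟩ :
      ∃ P₀, goodReductionHom W₀ (Valuation.integer.integers (specVal v)) hΔ P₀ = 0 ∧
        addOrderOf P₀ = p ^ 1 := by
    haveI : CharZero (AlgebraicClosure (v.adicCompletion ℚ)) := charZero_of_injective_algebraMap
      (algebraMap ℚ (AlgebraicClosure (v.adicCompletion ℚ))).injective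
    obtain ⟨P₀, h1, h2, -⟩ := exists_generator_torsionBy_ker_goodReductionHom
      (O := (specVal v).valuationSubring) (Valuation.integer.integers (specVal v)) hΔ hord 1
    exact ⟨P₀, h1, h2⟩
  set Q : localPoints W (v.adicCompletion ℚ) := Φ.symm P₀ with hQ
  have hP₀tors : p ^ 1 • P₀ = 0 := hordP₀ ▸ addOrderOf_nsmul_eq_zero P₀
  have hQtors : p ^ 1 • Q = 0 := by
    apply Φ.injective
    rw [map_nsmul, hQ, AddEquiv.apply_symm_apply, map_zero]
    exact hP₀tors
  obtain ⟨m, hm⟩ := exists_primaryTorsion_pointsMap_eq W p Q 1 hQtors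
  have hmC : m ∈ Lv.plus := by
    rw [hLv m, hredΦ, hm, hQ, AddEquiv.apply_symm_apply]
    exact hP₀0
  intro hbot
  have hm0 : m = 0 := (AddSubgroup.eq_bot_iff_forall _).mp hbot m hmC
  have hP₀eq : P₀ = 0 := by
    have hΦQ : Φ Q = P₀ := by rw [hQ, AddEquiv.apply_symm_apply]
    rw [← hΦQ, ← hm, hm0, ZeroMemClass.coe_zero, map_zero, map_zero]
  have h1 : addOrderOf P₀ = 1 := by rw [hP₀eq]; exact addOrderOf_zero
  rw [hordP₀, pow_one] at h1
  exact hp.out.one_lt.ne' h1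

set_option maxHeartbeats 400000 in -- buildfix 08-21: lake build timed out at the default 200000 (:282 whnf); cliff probe fails ≤160000
include hred hord in
/-- **The reductions of the `p`-power torsion form an INFINITE set** under the ordinary hypothesis:
for every `r`, the reduction map on `E[p^r]` (`p^{2r}` points over the algebraically closed `K̄_v`,
`card_torsionBy_eq_sq`) has kernel of order `p^r` (`natCard_torsionBy_ker_goodReductionHom_eq`), hence
an image of order `p^r` (first isomorphism theorem), which consists of reductions of ALGEBRAIC
`p`-power torsion points (`exists_primaryTorsion_pointsMap_eq`). Greenberg's "`Ẽ[p^∞] ≅ ℚ_p/ℤ_p`"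
over the good field. [cite: GreenbergLNM1716, §1 p. 62 and §2 p. 63] [cite: SilvermanAEC2009, Cor. III.6.4(b)] -/
theorem infinite_range_red_pointsMap (hpv : ((p : ℕ) : 𝓞 ℚ) ∈ v.asIdeal) :
    (Set.range fun m : W.geomPrimaryTorsion p ↦
      red (pointsMap W (v.adicCompletion ℚ) (m : W.geomPoints))).Infinite := by
  haveI := charP_residueField_specVal p hpv
  haveI hW₀ell : W₀.IsElliptic := ⟨hΔ⟩
  let Φ₁ : localPoints W (v.adicCompletion ℚ) ≃+
      ((W.baseChange (v.adicCompletion ℚ)).baseChange (AlgebraicClosure (v.adicCompletion ℚ))).toAffine.Point :=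
    Affine.Point.congrEquiv (baseChange_baseChange_adicCompletion W v).symm
  set Φ : localPoints W (v.adicCompletion ℚ) ≃+
      (W₀.baseChange (AlgebraicClosure (v.adicCompletion ℚ))).toAffine.Point :=
    (Φ₁.trans (VariableChange.pointEquiv _ C)).trans (Affine.Point.congrEquiv hW₀) with hΦ
  have hredΦ : ∀ P, red P = goodReductionHom W₀ (Valuation.integer.integers (specVal v)) hΔ (Φ P) :=
    fun P ↦ hred P
  set red₀ := goodReductionHom W₀ (Valuation.integer.integers (specVal v)) hΔ with hred₀
  -- (`CharZero K̄_v` is put in scope only now: with it, `DivisionRing.toRatAlgebra` competes with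
  -- the `ℚ`-algebra structure of `K̄_v` used by `W.baseChange`, cf. `OrdinaryReductionKernelTorsionProofs`)
  haveI : CharZero (AlgebraicClosure (v.adicCompletion ℚ)) := charZero_of_injective_algebraMap
    (algebraMap ℚ (AlgebraicClosure (v.adicCompletion ℚ))).injective
  set S := Set.range fun m : W.geomPrimaryTorsion p ↦
      red (pointsMap W (v.adicCompletion ℚ) (m : W.geomPoints)) with hS
  intro hfin
  -- `N = #S`, and `r` with `N < p^r`
  set N := Nat.card S with hN
  obtain ⟨r, hr⟩ : ∃ r : ℕ, N < p ^ r := ⟨N, Nat.lt_pow_self hp.out.one_lt⟩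
  -- the reduction map on `W₀(K̄_v)[p^r]`
  set V := (W₀.baseChange (AlgebraicClosure (v.adicCompletion ℚ))).toAffine.Point with hV
  set g : AddSubgroup.torsionBy V ((p ^ r : ℕ) : ℤ) →+
      (W₀.map (IsLocalRing.residue (specVal v).integer)).toAffine.Point :=
    red₀.comp (AddSubgroup.torsionBy V ((p ^ r : ℕ) : ℤ)).subtype with hg
  -- `#E[p^r] = p^{2r}`
  have hpr0 : ((p ^ r : ℕ) : AlgebraicClosure (v.adicCompletion ℚ)) ≠ 0 := by
    exact_mod_cast pow_ne_zero r hp.out.ne_zero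
  have hcardT : Nat.card (AddSubgroup.torsionBy V ((p ^ r : ℕ) : ℤ)) = (p ^ r) ^ 2 :=
    card_torsionBy_eq_sq (E := W₀.baseChange (AlgebraicClosure (v.adicCompletion ℚ))) hpr0
  -- `#ker g = p^r`
  have hker : Nat.card g.ker = p ^ r := by
    have h1 := (natCard_torsionBy_ker_goodReductionHom_eq (O := (specVal v).valuationSubring)
      (Valuation.integer.integers (specVal v)) hΔ hord r).1
    refine Eq.trans ?_ h1
    refine Nat.card_congr ⟨fun x ↦ ⟨⟨(x.1 : V), ?_⟩, ?_⟩, fun y ↦ ⟨⟨(y.1.1 : V), ?_⟩, ?_⟩,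
      fun x ↦ ?_, fun y ↦ ?_⟩
    · exact (AddMonoidHom.mem_ker).mp x.2
    · have hx : ((p ^ r : ℕ) : ℤ) • (x.1 : V) = 0 := mem_torsionBy_iff.mp x.1.2
      refine mem_torsionBy_iff.mpr (Subtype.ext ?_)
      change ((p : ℤ) ^ r) • (x.1 : V) = 0
      rw [← Nat.cast_pow]; exact hx
    · have hy : ((p : ℤ) ^ r) • y.1 = 0 := mem_torsionBy_iff.mp y.2
      have hy' := congrArg Subtype.val hy
      change ((p : ℤ) ^ r) • (y.1.1 : V) = 0 at hy'
      refine mem_torsionBy_iff.mpr ?_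
      rw [Nat.cast_pow]; exact hy'
    · exact (AddMonoidHom.mem_ker).mpr y.1.2
    · rfl
    · rfl
  -- `#E[p^r] = #range g · #ker g`
  have hmul : Nat.card (AddSubgroup.torsionBy V ((p ^ r : ℕ) : ℤ)) =
      Nat.card g.range * Nat.card g.ker := by
    rw [g.ker.card_eq_card_quotient_mul_card_addSubgroup,
      Nat.card_congr (QuotientAddGroup.quotientKerEquivRange g).toEquiv]
  -- `range g ⊆ S`
  haveI : Finite S := hfin.to_subtype
  have hsub : ∀ y : g.range, (y : (W₀.map (IsLocalRing.residue (specVal v).integer)).toAffine.Point) ∈ S := by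
    rintro ⟨y, ⟨P, hP⟩, rfl⟩
    have hPt : p ^ r • Φ.symm (P : V) = 0 := by
      apply Φ.injective
      rw [map_nsmul, AddEquiv.apply_symm_apply, map_zero, ← natCast_zsmul]
      exact mem_torsionBy_iff.mp hP
    obtain ⟨m, hm⟩ := exists_primaryTorsion_pointsMap_eq W p (Φ.symm (P : V)) r hPt
    refine ⟨m, ?_⟩
    change red (pointsMap W (v.adicCompletion ℚ) (m : W.geomPoints)) = red₀ (P : V)
    rw [hredΦ, hm, AddEquiv.apply_symm_apply]
  have hle : Nat.card g.range ≤ N := by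
    rw [hN]
    exact Nat.card_le_card_of_injective (fun y ↦ (⟨(y : _), hsub y⟩ : S))
      (fun y y' h ↦ Subtype.ext (by simpa using congrArg Subtype.val h))
  -- count: `#range g = p^r > N`
  rw [hcardT, hker] at hmul
  have h3 : Nat.card g.range = p ^ r :=
    (Nat.eq_of_mul_eq_mul_right (pow_pos hp.out.pos r) ((sq (p ^ r)).symm.trans hmul).symm)
  exact absurd (h3 ▸ hle) (not_le.mpr hr)

end Local

end Summit.BirchSwinnertonDyer.Rank1Residual.Additive.GoodModelLine

end
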